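import Literature.Computability.AlgebraicComplexity.LevelTriples
import HarnessLib

/-!
# Compatibility′ (Vassilevska Williams–Xu–Xu–Zhou 2024, Def. 5.15) and its equivalence with
compatibility (Def. 5.8) for triples consistent with `α` — definitions and proofs

Topic `Literature/Computability/AlgebraicComplexity`.  In the proof of Claim 5.14 (the value of
`p_comp`), Vassilevska Williams–Xu–Xu–Zhou (SODA 2024, arXiv:2307.07970, §5.6) rewrite compatibility
of a level-1 `Z`-block `K̂` with a block triple `X_I Y_J Z_K` consistent with `α` as a family of
constraints on DISJOINT sets of positions:

> **Definition 5.15 (Compatibility′).** For a level-`ℓ` triple `X_I Y_J Z_K` consistent with `α`, a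
> level-1 block `Z_K̂ ∈ Z_K` is compatible with `X_I Y_J Z_K` if
> * for every `(i,j,k)` with `i + j + k = 2^ℓ`, `i = 0` or `j = 0`: `split(K̂, S_{i,j,k}) = γ_{Z,i,j,k}`;
> * for every `k`, let `S_{+,+,k} = ⋃_{i>0, j>0} S_{i,j,k}`; then `split(K̂, S_{+,+,k}) = γ̄_{Z,+,+,k}`
>   (`γ̄_{Z,+,+,k} = (1/α(+,+,k)) ∑_{i,j>0} α(i,j,k) γ_{Z,i,j,k}`, §5 preamble).
>
> [The first item] and the second condition above imply the original condition
> `split(K̂, S_{*,*,k}) = γ̄_{Z,*,*,k}` … Similarly, [the two items of Def. 5.8] together imply the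
> second condition in Def. 5.15. Therefore, Def. 5.15 is an equivalent definition of compatibility.

This file DEFINES `S_{+,+,k}` (`posClassPP`), `γ̄_{Z,+,+,k}` (`gammaBarZPP`) and Compatibility′
(`IsCompatibleWith'`), and PROVES the displayed equivalence for `α`-consistent block triples
(`isCompatibleWith_iff_isCompatibleWith'`), through the averaging identity over the partition
`S_{*,*,k} = S_{+,+,k} ⊔ ⨆_{i=0 ∨ j=0} S_{i,j,k}` (`completeSplitOn_posClassZ_mul_card_eq_pp_add`).  As in
`LevelTriples.lean`, split distributions over EMPTY classes are unconstrained (guarded by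
non-emptiness; undefined in print), and the sums over `i` are indexed by `i ∈ {0,…,2c}` with
`j = 2c − k − i` truncated in `ℕ` (extra terms vanish for `α` supported on constituent triples, see
`gammaBarZ`).  Everything is proved; no named facts.

## References

* V. Vassilevska Williams, Y. Xu, Z. Xu, R. Zhou, *New bounds for matrix multiplication: from alpha
  to omega*, SODA 2024, arXiv:2307.07970 (held: `paper:arxiv-2307.07970`): §5 preamble
  (`α(+,+,k)`, `γ̄_{Z,+,+,k}`), §5.3 Def. 5.8, §5.6 Def. 5.15 and the discussion following it.
  [VassilevskaWilliamsXuXuZhou2024]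
-/

noncomputable section

open scoped BigOperators
open Finset

namespace Literature.Computability.AlgebraicComplexity

section CompatPrime

variable {c n : ℕ}

/-- **`S_{+,+,k} = ⋃_{i>0,j>0} S_{i,j,k} = {t | K_t = k, I_t ≠ 0, J_t ≠ 0}`.** [cite: VassilevskaWilliamsXuXuZhou2024, Def. 5.15 (S_{+,+,k})] -/
def posClassPP (I J K : Fin n → ℕ) (k : ℕ) : Finset (Fin n) :=
  univ.filter fun t => K t = k ∧ I t ≠ 0 ∧ J t ≠ 0

/-- Membership in `S_{+,+,k}`. [cite: VassilevskaWilliamsXuXuZhou2024, Def. 5.15] -/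
@[simp] theorem mem_posClassPP {I J K : Fin n → ℕ} {k : ℕ} {t : Fin n} :
    t ∈ posClassPP I J K k ↔ K t = k ∧ I t ≠ 0 ∧ J t ≠ 0 := by
  simp [posClassPP]

/-- The "boundary" part of `S_{*,*,k}`: positions with `I_t = 0` or `J_t = 0`.
[cite: VassilevskaWilliamsXuXuZhou2024, Def. 5.8 (1) / Def. 5.15 (1)] -/
def posClassBd (I J K : Fin n → ℕ) (k : ℕ) : Finset (Fin n) :=
  univ.filter fun t => K t = k ∧ (I t = 0 ∨ J t = 0)

/-- Membership in the boundary part. [folklore] -/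
@[simp] theorem mem_posClassBd {I J K : Fin n → ℕ} {k : ℕ} {t : Fin n} :
    t ∈ posClassBd I J K k ↔ K t = k ∧ (I t = 0 ∨ J t = 0) := by
  simp [posClassBd]

/-- `S_{*,*,k} = S_{+,+,k} ⊔ (boundary part)`, as a disjoint union. [cite: VassilevskaWilliamsXuXuZhou2024, Def. 5.15 (discussion)] -/
theorem posClassZ_eq_pp_union_bd (I J K : Fin n → ℕ) (k : ℕ) :
    posClassZ K k = posClassPP I J K k ∪ posClassBd I J K k := by
  ext t
  simp only [mem_posClassZ, mem_union, mem_posClassPP, mem_posClassBd]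
  constructor
  · intro hk
    by_cases hi : I t = 0
    · exact Or.inr ⟨hk, Or.inl hi⟩
    by_cases hj : J t = 0
    · exact Or.inr ⟨hk, Or.inr hj⟩
    exact Or.inl ⟨hk, hi, hj⟩
  · rintro (⟨hk, -, -⟩ | ⟨hk, -⟩) <;> exact hk

/-- The two parts are disjoint. [folklore] -/
theorem disjoint_posClassPP_posClassBd (I J K : Fin n → ℕ) (k : ℕ) :
    Disjoint (posClassPP I J K k) (posClassBd I J K k) := by
  rw [Finset.disjoint_left]
  intro t h1 h2
  rw [mem_posClassPP] at h1
  rw [mem_posClassBd] at h2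
  rcases h2.2 with h | h
  · exact h1.2.1 h
  · exact h1.2.2 h

/-- The boundary part decomposes over `i` into the classes `S_{i,2c-k-i,k}` with `i = 0` or
`2c − k − i = 0`. [cite: VassilevskaWilliamsXuXuZhou2024, Def. 5.15 (discussion)] -/
theorem card_filter_posClassBd_eq_sum {I J K : Fin n → ℕ} (h : IsLevelTriple c I J K) (k : ℕ)
    (p : Fin n → Prop) [DecidablePred p] :
    ((posClassBd I J K k).filter p).card =
      ∑ i ∈ (range (2 * c + 1)).filter (fun i => i = 0 ∨ 2 * c - k - i = 0),
        ((posClass I J K i (2 * c - k - i) k).filter p).card := by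
  rw [card_eq_sum_card_fiberwise (f := I) (s := (posClassBd I J K k).filter p)
    (t := (range (2 * c + 1)).filter fun i => i = 0 ∨ 2 * c - k - i = 0)]
  · refine sum_congr rfl fun i hi => ?_
    congr 1
    ext t
    simp only [mem_filter, mem_posClassBd, mem_posClass]
    have := h t
    obtain ⟨-, hi0⟩ := mem_filter.1 hi
    constructor
    · rintro ⟨⟨⟨hk, _⟩, hp⟩, hIi⟩
      exact ⟨⟨hIi, by omega, hk⟩, hp⟩
    · rintro ⟨⟨hIi, hJ, hk⟩, hp⟩
      refine ⟨⟨⟨hk, ?_⟩, hp⟩, hIi⟩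
      rcases hi0 with h0 | h0
      · exact Or.inl (hIi.trans h0)
      · exact Or.inr (hJ.trans h0)
  · intro t ht
    rw [mem_coe, mem_filter, mem_posClassBd] at ht
    obtain ⟨⟨hk, hij⟩, -⟩ := ht
    have := h t
    rw [mem_coe, mem_filter, mem_range]
    refine ⟨by omega, ?_⟩
    rcases hij with h0 | h0
    · exact Or.inl h0
    · exact Or.inr (by omega)

/-- The `+,+` part decomposes over `i` into the classes `S_{i,2c-k-i,k}` with `i > 0` and `2c−k−i > 0`.
[cite: VassilevskaWilliamsXuXuZhou2024, Def. 5.15 (S_{+,+,k} = ⋃_{i>0,j>0} S_{i,j,k})] -/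
theorem card_filter_posClassPP_eq_sum {I J K : Fin n → ℕ} (h : IsLevelTriple c I J K) (k : ℕ)
    (p : Fin n → Prop) [DecidablePred p] :
    ((posClassPP I J K k).filter p).card =
      ∑ i ∈ (range (2 * c + 1)).filter (fun i => ¬ (i = 0 ∨ 2 * c - k - i = 0)),
        ((posClass I J K i (2 * c - k - i) k).filter p).card := by
  rw [card_eq_sum_card_fiberwise (f := I) (s := (posClassPP I J K k).filter p)
    (t := (range (2 * c + 1)).filter fun i => ¬ (i = 0 ∨ 2 * c - k - i = 0))]
  · refine sum_congr rfl fun i hi => ?_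
    congr 1
    ext t
    simp only [mem_filter, mem_posClassPP, mem_posClass]
    have := h t
    obtain ⟨-, hi0⟩ := mem_filter.1 hi
    constructor
    · rintro ⟨⟨⟨hk, _, _⟩, hp⟩, hIi⟩
      exact ⟨⟨hIi, by omega, hk⟩, hp⟩
    · rintro ⟨⟨hIi, hJ, hk⟩, hp⟩
      refine ⟨⟨⟨hk, ?_, ?_⟩, hp⟩, hIi⟩
      · intro hI0; exact hi0 (Or.inl (by rw [← hIi]; exact hI0))
      · intro hJ0; exact hi0 (Or.inr (by rw [← hJ]; exact hJ0))
  · intro t ht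
    rw [mem_coe, mem_filter, mem_posClassPP] at ht
    obtain ⟨⟨hk, hI, hJ⟩, -⟩ := ht
    have := h t
    rw [mem_coe, mem_filter, mem_range]
    refine ⟨by omega, ?_⟩
    rintro (h0 | h0)
    · exact hI h0
    · exact hJ (by omega)

/-- **`α(+,+,k) = ∑_{i,j>0} α(i,j,k)`** (as a sum over `i` with `j = 2c − k − i`).
[cite: VassilevskaWilliamsXuXuZhou2024, §5 (preamble: α(+,+,k))] -/
def alphaPP (c : ℕ) (α : ℕ × ℕ × ℕ → ℝ) (k : ℕ) : ℝ :=
  ∑ i ∈ (range (2 * c + 1)).filter (fun i => ¬ (i = 0 ∨ 2 * c - k - i = 0)), α (i, 2 * c - k - i, k)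

/-- **`γ̄_{Z,+,+,k} = (1/α(+,+,k)) ∑_{i,j>0} α(i,j,k) · γ_{Z,i,j,k}`.** [cite: VassilevskaWilliamsXuXuZhou2024, §5 (preamble: γ̄_{Z,+,+,k})] -/
def gammaBarZPP (c : ℕ) (α : ℕ × ℕ × ℕ → ℝ) (γZ : ℕ × ℕ × ℕ → (Fin c → Fin 3) → ℝ) (k : ℕ) :
    (Fin c → Fin 3) → ℝ := fun σ =>
  (∑ i ∈ (range (2 * c + 1)).filter (fun i => ¬ (i = 0 ∨ 2 * c - k - i = 0)),
      α (i, 2 * c - k - i, k) * γZ (i, 2 * c - k - i, k) σ) / alphaPP c α k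

/-- **Def. 5.15 (Compatibility′)**: (1) `split(K̂, S_{i,j,k}) = γ_{Z,i,j,k}` for the occurring classes
with `i = 0` or `j = 0`; (2′) `split(K̂, S_{+,+,k}) = γ̄_{Z,+,+,k}` for every `k` with `S_{+,+,k} ≠ ∅`.
[cite: VassilevskaWilliamsXuXuZhou2024, Def. 5.15] -/
def IsCompatibleWith' (c : ℕ) (α : ℕ × ℕ × ℕ → ℝ) (γZ : ℕ × ℕ × ℕ → (Fin c → Fin 3) → ℝ)
    (I J K : Fin n → ℕ) (Kh : Fin n → Fin c → Fin 3) : Prop :=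
  (∀ i j k, (i = 0 ∨ j = 0) → (posClass I J K i j k).Nonempty →
      completeSplitOn Kh (posClass I J K i j k) = γZ (i, j, k)) ∧
    ∀ k, (posClassPP I J K k).Nonempty → completeSplitOn Kh (posClassPP I J K k) = gammaBarZPP c α γZ k

/-- **The averaging identity over `S_{*,*,k} = S_{+,+,k} ⊔ boundary`**:
`split(K̂, S_{*,*,k})·|S_{*,*,k}| = split(K̂, S_{+,+,k})·|S_{+,+,k}| + ∑_{i=0∨j=0} split(K̂, S_{i,j,k})·|S_{i,j,k}|`.
[cite: VassilevskaWilliamsXuXuZhou2024, Def. 5.15 (the displayed computation)] -/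
theorem completeSplitOn_posClassZ_mul_card_eq_pp_add {I J K : Fin n → ℕ} (h : IsLevelTriple c I J K)
    (Kh : Fin n → Fin c → Fin 3) (k : ℕ) (σ : Fin c → Fin 3) :
    completeSplitOn Kh (posClassZ K k) σ * (posClassZ K k).card =
      completeSplitOn Kh (posClassPP I J K k) σ * (posClassPP I J K k).card +
        ∑ i ∈ (range (2 * c + 1)).filter (fun i => i = 0 ∨ 2 * c - k - i = 0),
          completeSplitOn Kh (posClass I J K i (2 * c - k - i) k) σ * (posClass I J K i (2 * c - k - i) k).card := by
  rw [completeSplitOn_mul_card, completeSplitOn_mul_card, posClassZ_eq_pp_union_bd I J K k,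
    filter_union, card_union_of_disjoint (disjoint_filter_filter (disjoint_posClassPP_posClassBd I J K k)),
    Nat.cast_add, card_filter_posClassBd_eq_sum h k]
  push_cast
  congr 1
  exact sum_congr rfl fun i _ => (completeSplitOn_mul_card Kh _ σ).symm

/-- The size of `S_{+,+,k}` of an `α`-consistent triple: `|S_{+,+,k}| = α(+,+,k) · n`.
[cite: VassilevskaWilliamsXuXuZhou2024, §5 (α(+,+,k)) and §5.2 (consistency with α)] -/
theorem card_posClassPP_eq {α : ℕ × ℕ × ℕ → ℝ} {I J K : Fin n → ℕ} (h : IsLevelTriple c I J K)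
    (hα : IsAlphaConsistent α I J K) (k : ℕ) : ((posClassPP I J K k).card : ℝ) = alphaPP c α k * n := by
  have := card_filter_posClassPP_eq_sum h k (fun _ => True)
  simp only [Finset.filter_true_of_mem (fun _ _ => trivial)] at this
  rw [this, alphaPP, sum_mul]
  push_cast
  exact sum_congr rfl fun i _ => by simpa using hα i (2 * c - k - i) k

/-- **Def. 5.8 ⇔ Def. 5.15 for `α`-consistent block triples** ("Therefore, Def. 5.15 is an equivalent
definition of compatibility"). [cite: VassilevskaWilliamsXuXuZhou2024, Def. 5.15 (discussion)] -/
theorem isCompatibleWith_iff_isCompatibleWith' {α : ℕ × ℕ × ℕ → ℝ}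
    {γZ : ℕ × ℕ × ℕ → (Fin c → Fin 3) → ℝ} {I J K : Fin n → ℕ} {Kh : Fin n → Fin c → Fin 3}
    (hlev : IsLevelTriple c I J K) (hα : IsAlphaConsistent α I J K) :
    IsCompatibleWith c α γZ I J K Kh ↔ IsCompatibleWith' c α γZ I J K Kh := by
  -- common data
  have hn : ∀ {S : Finset (Fin n)}, S.Nonempty → (n : ℝ) ≠ 0 := fun ⟨t, _⟩ => by
    have : 0 < n := Fin.pos t
    exact_mod_cast this.ne'
  -- the boundary terms are determined by item (1) (shared by both definitions)
  have hbd : ∀ (k : ℕ) (σ : Fin c → Fin 3),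
      (∀ i j k, (i = 0 ∨ j = 0) → (posClass I J K i j k).Nonempty →
        completeSplitOn Kh (posClass I J K i j k) = γZ (i, j, k)) →
      ∑ i ∈ (range (2 * c + 1)).filter (fun i => i = 0 ∨ 2 * c - k - i = 0),
          completeSplitOn Kh (posClass I J K i (2 * c - k - i) k) σ * (posClass I J K i (2 * c - k - i) k).card =
        (∑ i ∈ (range (2 * c + 1)).filter (fun i => i = 0 ∨ 2 * c - k - i = 0),
          α (i, 2 * c - k - i, k) * γZ (i, 2 * c - k - i, k) σ) * n := by
    intro k σ h1
    rw [sum_mul]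
    refine sum_congr rfl fun i hi => ?_
    obtain ⟨-, hi0⟩ := mem_filter.1 hi
    rcases (posClass I J K i (2 * c - k - i) k).eq_empty_or_nonempty with he | hne
    · have h0 : α (i, 2 * c - k - i, k) * n = 0 := by rw [← hα, he, card_empty, Nat.cast_zero]
      rw [he, card_empty, Nat.cast_zero, mul_zero, mul_assoc, mul_comm (γZ _ σ), ← mul_assoc, h0, zero_mul]
    · rw [h1 i _ k hi0 hne, hα]; ring
  -- `|S_{*,*,k}| = (∑_i α) n`, and the split of the sum into `+,+` and boundary parts
  have hcardZ : ∀ k, ((posClassZ K k).card : ℝ) = (∑ i ∈ range (2 * c + 1), α (i, 2 * c - k - i, k)) * n := by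
    intro k
    rw [card_posClassZ_eq_sum hlev k]
    push_cast
    rw [sum_mul]
    exact sum_congr rfl fun i _ => hα _ _ _
  have hsplitα : ∀ k, ∑ i ∈ range (2 * c + 1), α (i, 2 * c - k - i, k) =
      alphaPP c α k + ∑ i ∈ (range (2 * c + 1)).filter (fun i => i = 0 ∨ 2 * c - k - i = 0),
        α (i, 2 * c - k - i, k) := by
    intro k
    rw [alphaPP, ← sum_filter_add_sum_filter_not (range (2 * c + 1)) (fun i => i = 0 ∨ 2 * c - k - i = 0), add_comm]
  have hsplitαγ : ∀ (k : ℕ) (σ : Fin c → Fin 3), ∑ i ∈ range (2 * c + 1), α (i, 2 * c - k - i, k) * γZ (i, 2 * c - k - i, k) σ =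
      (∑ i ∈ (range (2 * c + 1)).filter (fun i => ¬ (i = 0 ∨ 2 * c - k - i = 0)),
        α (i, 2 * c - k - i, k) * γZ (i, 2 * c - k - i, k) σ) +
      ∑ i ∈ (range (2 * c + 1)).filter (fun i => i = 0 ∨ 2 * c - k - i = 0),
        α (i, 2 * c - k - i, k) * γZ (i, 2 * c - k - i, k) σ := by
    intro k σ
    rw [← sum_filter_add_sum_filter_not (range (2 * c + 1)) (fun i => i = 0 ∨ 2 * c - k - i = 0), add_comm]
  constructor
  · rintro ⟨h1, htyp⟩
    refine ⟨h1, fun k hne => ?_⟩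
    funext σ
    have hZne : (posClassZ K k).Nonempty := by
      obtain ⟨t, ht⟩ := hne
      exact ⟨t, mem_posClassZ.2 (mem_posClassPP.1 ht).1⟩
    have hT := congrFun (htyp k hZne) σ
    have hden : (∑ i ∈ range (2 * c + 1), α (i, 2 * c - k - i, k)) ≠ 0 := by
      intro h0
      have := hcardZ k
      rw [h0, zero_mul] at this
      exact absurd this (by exact_mod_cast hZne.card_pos.ne')
    have hPP : alphaPP c α k ≠ 0 := by
      intro h0
      have := card_posClassPP_eq hlev hα k
      rw [h0, zero_mul] at this
      exact absurd this (by exact_mod_cast hne.card_pos.ne')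
    -- the averaging identity with all known values substituted
    have havg := completeSplitOn_posClassZ_mul_card_eq_pp_add hlev Kh k σ
    rw [hT, hbd k σ h1, hcardZ k, card_posClassPP_eq hlev hα k] at havg
    have hL : gammaBarZ c α γZ k σ * ((∑ i ∈ range (2 * c + 1), α (i, 2 * c - k - i, k)) * n) =
        (∑ i ∈ range (2 * c + 1), α (i, 2 * c - k - i, k) * γZ (i, 2 * c - k - i, k) σ) * n := by
      simp only [gammaBarZ]
      field_simp
    rw [hL, hsplitαγ k σ] at havg
    -- `havg : (Σ_pp + Σ_bd) n = split(PP) (αPP n) + Σ_bd n`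
    have key : (∑ i ∈ (range (2 * c + 1)).filter (fun i => ¬ (i = 0 ∨ 2 * c - k - i = 0)),
        α (i, 2 * c - k - i, k) * γZ (i, 2 * c - k - i, k) σ) * n =
        (completeSplitOn Kh (posClassPP I J K k) σ * alphaPP c α k) * n := by
      linear_combination havg
    have key' := mul_right_cancel₀ (hn hne) key
    simp only [gammaBarZPP]
    rw [eq_div_iff hPP]
    exact key'.symm
  · rintro ⟨h1, hpp⟩
    refine ⟨h1, fun k hZne => ?_⟩
    funext σ
    have havg := completeSplitOn_posClassZ_mul_card_eq_pp_add hlev Kh k σ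
    rw [hbd k σ h1, hcardZ k] at havg
    have hden : (∑ i ∈ range (2 * c + 1), α (i, 2 * c - k - i, k)) ≠ 0 := by
      intro h0
      have := hcardZ k
      rw [h0, zero_mul] at this
      exact absurd this (by exact_mod_cast hZne.card_pos.ne')
    -- the `+,+` term: either `S_{+,+,k} = ∅` (then every `α(i,j,k)`, `i,j > 0`, vanishes) or given by `hpp`
    have hPPterm : completeSplitOn Kh (posClassPP I J K k) σ * (posClassPP I J K k).card =
        (∑ i ∈ (range (2 * c + 1)).filter (fun i => ¬ (i = 0 ∨ 2 * c - k - i = 0)),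
          α (i, 2 * c - k - i, k) * γZ (i, 2 * c - k - i, k) σ) * n := by
      rcases (posClassPP I J K k).eq_empty_or_nonempty with he | hne
      · rw [he, card_empty, Nat.cast_zero, mul_zero, sum_mul]
        symm
        refine sum_eq_zero fun i hi => ?_
        have hcl : posClass I J K i (2 * c - k - i) k = ∅ := by
          rw [← Finset.subset_empty, ← he]
          intro t ht
          obtain ⟨hIi, hJ, hk⟩ := mem_posClass.1 ht
          obtain ⟨-, hi0⟩ := mem_filter.1 hi
          refine mem_posClassPP.2 ⟨hk, ?_, ?_⟩
          · intro h0; exact hi0 (Or.inl (by rw [← hIi]; exact h0))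
          · intro h0; exact hi0 (Or.inr (by rw [← hJ]; exact h0))
        have h0 : α (i, 2 * c - k - i, k) * n = 0 := by rw [← hα, hcl, card_empty, Nat.cast_zero]
        rw [mul_assoc, mul_comm (γZ _ σ), ← mul_assoc, h0, zero_mul]
      · rw [congrFun (hpp k hne) σ, card_posClassPP_eq hlev hα k]
        have hPP : alphaPP c α k ≠ 0 := by
          intro h0
          have := card_posClassPP_eq hlev hα k
          rw [h0, zero_mul] at this
          exact absurd this (by exact_mod_cast hne.card_pos.ne')
        simp only [gammaBarZPP]
        field_simp
    rw [hPPterm, ← add_mul, ← hsplitαγ k σ] at havg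
    -- `havg : split(Z) (ΣA n) = ΣAG n`
    have h3 : completeSplitOn Kh (posClassZ K k) σ * (∑ i ∈ range (2 * c + 1), α (i, 2 * c - k - i, k)) =
        ∑ i ∈ range (2 * c + 1), α (i, 2 * c - k - i, k) * γZ (i, 2 * c - k - i, k) σ :=
      mul_right_cancel₀ (hn hZne) (by rw [mul_assoc]; exact havg)
    simp only [gammaBarZ]
    rw [eq_div_iff hden]
    exact h3

end CompatPrime

end Literature.Computability.AlgebraicComplexity
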